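import Summits.Langlands.Langlands.Theorems.IrreducibilityBySelfDualityIrreducibleOffSectorRankTwoRational
import Literature.NumberTheory.Automorphic.HeckeLatticeCount
import HarnessLib

/-!
# `IrreducibleOffSector` in ranks two and three from L-ARITHMETICITY of `π` (Buzzard–Gee Conj. 3.1.6)
(crux stmt-Langlands-14329 `IrreducibilityBySelfDuality.IrreducibleOffSector`, line `Sketch`;
`--supports` file, STRUCTURAL: no import of the route module)

The rank-two and rank-three children `isIrreducible_rank_two_of_rational` (p117233) and
`isIrreducible_rank_three_of_not_essSelfDual_of_exists_rational` (p117816) reduce the crux,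
for an ARBITRARY cuspidal `π`, to the existence of an `E`-RATIONAL avatar.  `E`-rationality of an
avatar `ρ` (Frobenius polynomials `∏_j (X - ι⁻¹(α_j⁻¹))` over a number field at almost all places) is
an AUTOMORPHIC property of `π`: it holds as soon as the unramified Hecke eigenvalues of `π` — the
elementary symmetric functions `e_i(t_{π,v})` of the Satake parameters — lie in a fixed number field
`E ⊂ ℂ` at almost all `v`, i.e. as soon as `π` is **L-arithmetic** (Buzzard–Gee 2014, Def. 3.1.4 at
the unramified places).  For L-algebraic `π` this is Buzzard–Gee's Conjecture 3.1.6 ("L-algebraic ⇒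
L-arithmetic"), a theorem for regular `π` (Clozel 1990, Thm. 3.13, through the C-algebraic twist) and
OPEN for irregular `π` (e.g. Maass forms of eigenvalue `¼`).  This file records the resulting
conjecture-conditional bridges — the planner may file the hypothesis `hLA` as a `@[conjecture]` item:

* `prod_X_sub_C_inv`, `exists_polynomial_map_subtype_eq_prod_X_sub_C_inv`,
  `exists_polynomial_map_eq_arithFrobPolyOfSatake_one_of_esymm_mem` — algebra: if `e_i(α) ∈ E` for
  all `i` and the `α_j` are non-zero, then `∏_j (X - α_j⁻¹) = (-1)^n e_n(α)⁻¹ ∏_j (1 - α_j X)` has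
  coefficients in `E` (reciprocal Vieta, `multiset_prod_one_sub_C_mul_X_eq_sum_esymm`), so
  `arithFrobPolyOfSatake ι q 1 α` is defined over `E` via `ι⁻¹|_E`;
* `eventually_rational_of_esymm_mem` — an avatar of an L-arithmetic `π` is `E`-rational a.e.;
* `isIrreducible_rank_two_of_isLArithmetic` — rank 2, ANY `K`, ANY cuspidal `π` that is L-arithmetic
  at almost all unramified places: every a.e.-compatible `ρ` is irreducible (⟸ `WeakAbelianSummandHecke`
  text ∧ Arthur–Clozel (2.2));
* (follow-up file `…OfArithmeticRankThree`, on top of `…RankThreeRational` p117816)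
  `isIrreducible_rank_three_of_not_essSelfDual_of_isLArithmetic` — rank 3, ANY `K`, ANY cuspidal
  L-arithmetic `π` that is not essentially self-dual at Satake level: the same;
* `irreducibleOffSector_text_rank_two_of_isLArithmetic` — the rank-two slice of the crux text,
  VERBATIM, from `WeakAbelianSummandHecke` ∧ (2.2) ∧ [Buzzard–Gee Conj. 3.1.6 for cuspidal `GL_2`]:
  in rank two, irreducibility is no harder than arithmeticity.

References: K. Buzzard, T. Gee, LMS LNS 414 (2014), Def. 3.1.4, Conj. 3.1.6, §5.3; L. Clozel (1990),
Thm. 3.13; G. Böckle, C.-Y. Hui, Math. Ann. 393 (2025), Thm. 1.1, §3.1–3.2.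
-/

noncomputable section

set_option linter.dupNamespace false

open scoped NumberField Classical Polynomial
open Filter IsDedekindDomain NumberField Polynomial
open Literature.NumberTheory.Automorphic Literature.NumberTheory.GaloisRepresentations
open Summit.Langlands

namespace Summit.Langlands.Langlands.Theorems.IrreducibleOffSector

/-! ### Algebra: `∏ (X - α_j⁻¹)` is defined over the field of the `e_i(α)` -/

section Algebra

/-- `e_{|s|}(s) = ∏ s` (Mathlib `Multiset.powersetCard_self`). [folklore] -/
private theorem esymm_card_eq_prod'' (s : Multiset ℂ) : s.esymm (Multiset.card s) = s.prod := by
  rw [Multiset.esymm, Multiset.powersetCard_self, Multiset.map_singleton, Multiset.sum_singleton]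

/-- **The inverse-root polynomial through the reciprocal polynomial**: for a multiset `α` of non-zero
complex numbers, `∏_{a ∈ α} (X - a⁻¹) = C(∏_{a ∈ α} (-a⁻¹)) · ∏_{a ∈ α} (1 - a X)`. [folklore] -/
theorem prod_X_sub_C_inv (α : Multiset ℂ) (hne : ∀ a ∈ α, a ≠ 0) :
    (α.map fun a => X - C a⁻¹).prod =
      C ((α.map fun a => -a⁻¹).prod) * (α.map fun a => (1 : ℂ[X]) - C a * X).prod := by
  rw [map_multiset_prod Polynomial.C, Multiset.map_map, ← Multiset.prod_map_mul]
  refine congrArg _ (Multiset.map_congr rfl fun a ha => ?_)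
  have h : C a⁻¹ * C a = (1 : ℂ[X]) := by rw [← C_mul, inv_mul_cancel₀ (hne a ha), C_1]
  simp only [Function.comp_apply, C_neg]
  linear_combination (-X) * h

/-- **`∏ (X - α_j⁻¹)` is defined over `E`** when every `e_i(α)` lies in the subfield `E ⊆ ℂ` and the
`α_j` are non-zero: by `prod_X_sub_C_inv` and the reciprocal Vieta formula
`∏ (1 - α_j X) = ∑_j (-1)^j e_j(α) X^j` every coefficient lies in `E`
(`∏ (-α_j⁻¹) = (-1)^n e_n(α)⁻¹`). [cite: BuzzardGeeLMS2014, Def. 3.1.4] -/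
theorem exists_polynomial_map_subtype_eq_prod_X_sub_C_inv (E : Subfield ℂ) {α : Multiset ℂ}
    (hne : ∀ a ∈ α, a ≠ 0) (hE : ∀ i ≤ Multiset.card α, α.esymm i ∈ E) :
    ∃ P : Polynomial E, P.map E.subtype = (α.map fun a => X - C a⁻¹).prod := by
  rw [← Polynomial.mem_lifts, prod_X_sub_C_inv α hne]
  refine mul_mem ?_ ?_
  · -- the constant `∏ (-a⁻¹) = (∏ a)⁻¹ · (-1)^n`, with `∏ a = e_n(α) ∈ E`
    have hc : (α.map fun a => -a⁻¹).prod ∈ E := by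
      have e : (α.map fun a => -a⁻¹) = (α.map fun a => a⁻¹).map Neg.neg := by
        rw [Multiset.map_map]; rfl
      rw [e, Multiset.prod_map_neg, Multiset.card_map, Multiset.prod_map_inv, Multiset.map_id',
        ← esymm_card_eq_prod'']
      exact mul_mem (pow_mem (neg_mem (one_mem E)) _) (inv_mem (hE _ le_rfl))
    exact Polynomial.C_mem_lifts E.subtype ⟨_, hc⟩
  · rw [multiset_prod_one_sub_C_mul_X_eq_sum_esymm]
    refine Subsemiring.sum_mem _ fun j hj => mul_mem ?_ (pow_mem (Polynomial.X_mem_lifts _) _)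
    have hj' : j ≤ Multiset.card α := Nat.lt_succ_iff.mp (Finset.mem_range.mp hj)
    exact Polynomial.C_mem_lifts E.subtype
      ⟨_, mul_mem (pow_mem (neg_mem (one_mem E)) _) (hE j hj')⟩

variable {ℓ : ℕ} [Fact ℓ.Prime]

/-- **`arithFrobPolyOfSatake ι q 1 α` is defined over the field of the `e_i(α)`** (via `ι⁻¹|_E`):
the summit-normalised Frobenius polynomial `∏_j (X - ι⁻¹(α_j⁻¹))` of an avatar of an L-arithmetic
`π`. [cite: BuzzardGeeLMS2014, Def. 3.1.4] -/
theorem exists_polynomial_map_eq_arithFrobPolyOfSatake_one_of_esymm_mem (ι : PadicAlgCl ℓ ≃+* ℂ)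
    (E : Subfield ℂ) (q : ℕ) {α : Multiset ℂ} (hne : ∀ a ∈ α, a ≠ 0)
    (hE : ∀ i ≤ Multiset.card α, α.esymm i ∈ E) :
    ∃ P : Polynomial E,
      P.map ((ι.symm : ℂ ≃+* PadicAlgCl ℓ).toRingHom.comp E.subtype) =
        arithFrobPolyOfSatake ι q 1 α := by
  obtain ⟨P, hP⟩ := exists_polynomial_map_subtype_eq_prod_X_sub_C_inv E hne hE
  refine ⟨P, ?_⟩
  rw [← Polynomial.map_map, hP, arithFrobPolyOfSatake_one, Polynomial.map_multiset_prod,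
    Multiset.map_map]
  congr 1
  refine Multiset.map_congr rfl fun a _ => ?_
  simp only [Function.comp_apply, Polynomial.map_sub, Polynomial.map_X, Polynomial.map_C,
    RingEquiv.toRingHom_eq_coe, RingEquiv.coe_toRingHom]

end Algebra

/-! ### Avatars of L-arithmetic `π` are `E`-rational -/

section Rational

variable {n : ℕ} {K : Type} [Field K] [NumberField K] {hcpt : isCompact_glFiniteIntegralLevel n K}
  {ℓ : ℕ} [Fact ℓ.Prime]

/-- **An avatar of an L-arithmetic `π` is `E`-rational almost everywhere.**  If the elementary
symmetric functions of the Satake parameters of `π` lie in the subfield `E ⊆ ℂ` at almost all places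
and `ρ` is Satake–Frobenius compatible with `(π, ι)` at almost all places, then at almost all `v`, `ρ`
is unramified with Frobenius polynomial defined over `E` (via `ι⁻¹|_E`). Satake parameters are
non-zero (`hasSatakeParamAt_ne_zero_holds`) of cardinality `n` (`HasSatakeParamAt.card_eq`).
[cite: BuzzardGeeLMS2014, Def. 3.1.4] [cite: BockleHui2025, §3.1] -/
theorem eventually_rational_of_esymm_mem (π : AutomorphicRepData (AutomorphyDatum.gl n K hcpt))
    (ι : PadicAlgCl ℓ ≃+* ℂ) (E : Subfield ℂ)
    (hE : ∀ᶠ v : HeightOneSpectrum (𝓞 K) in cofinite, ∀ α : Multiset ℂ, π.HasSatakeParamAt v α →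
      ∀ i ≤ n, α.esymm i ∈ E)
    (ρ : FramedGaloisRep K (PadicAlgCl ℓ) n)
    (hρ : ∀ᶠ v : HeightOneSpectrum (𝓞 K) in cofinite, SatakeFrobCompatibleAt ι π ρ v) :
    ∀ᶠ v : HeightOneSpectrum (𝓞 K) in cofinite, ρ.IsUnramifiedAt v ∧
      ∃ P : Polynomial E,
        ρ.HasFrobCharpolyAt v (P.map ((ι.symm : ℂ ≃+* PadicAlgCl ℓ).toRingHom.comp E.subtype)) := by
  filter_upwards [hρ, hE] with v hv hEv
  obtain ⟨α, hα, hur, hcp⟩ := hv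
  refine ⟨hur, ?_⟩
  obtain ⟨P, hP⟩ := exists_polynomial_map_eq_arithFrobPolyOfSatake_one_of_esymm_mem ι E v.residueCard
    (hasSatakeParamAt_ne_zero_holds hα) (fun i hi => hEv α hα i (hα.card_eq ▸ hi))
  exact ⟨P, fun 𝔓 h𝔓 σ hσ => (hcp 𝔓 h𝔓 σ hσ).trans hP.symm⟩

end Rational

/-! ### The bridges -/

/-- **Rank two: L-arithmetic cuspidal `π` have irreducible avatars** (every number field `K`, EVERY
cuspidal `π` on `GL_2(𝔸_K)` whose unramified Hecke eigenvalues `e_1(t_{π,v}), e_2(t_{π,v})` lie in a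
number field `E ⊂ ℂ` at almost all `v`; no archimedean hypothesis).  Grant Böckle–Hui 2025 Thm. 1.1
in cofinite `GL(1)` form (the text of the route item `WeakAbelianSummandHecke`) and Arthur–Clozel
(2.2).  Then every `ρ : Γ_K → GL_2(ℚ̄_ℓ)` Satake–Frobenius compatible with `(π, ι)` at almost all
places is irreducible: it is `E`-rational (`eventually_rational_of_esymm_mem`), so
`isIrreducible_rank_two_of_rational` (p117233) applies.
[cite: BockleHui2025, Theorem 1.1 and §3.2.1] [cite: BuzzardGeeLMS2014, Def. 3.1.4] -/
theorem isIrreducible_rank_two_of_isLArithmetic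
    (hWA : ∀ (K : Type) [Field K] [NumberField K] (h1 : isCompact_glFiniteIntegralLevel 1 K) (ℓ : ℕ) [Fact ℓ.Prime] (n : ℕ) (E : Type) [Field E] [NumberField E] (e : E →+* PadicAlgCl ℓ) (ρ : Literature.NumberTheory.GaloisRepresentations.FramedGaloisRep K (PadicAlgCl ℓ) n), ρ.toGaloisRep.IsSemisimple → (∀ᶠ v in cofinite, ρ.IsUnramifiedAt v ∧ ∃ P : Polynomial E, ρ.HasFrobCharpolyAt v (P.map e)) → ∀ (ψ : Literature.NumberTheory.GaloisRepresentations.FramedGaloisRep K (PadicAlgCl ℓ) 1), (∀ᶠ v in cofinite, ρ.IsUnramifiedAt v ∧ ψ.IsUnramifiedAt v ∧ ∀ 𝔓 ∈ v.primesAbove, ∀ σ : Field.absoluteGaloisGroup K, IsArithFrobAt (NumberField.RingOfIntegers K) σ 𝔓 → ψ.charpoly σ ∣ ρ.charpoly σ) → ∀ (ι : PadicAlgCl ℓ ≃+* ℂ), ∃ χ : Literature.NumberTheory.Automorphic.CuspidalAutomorphicRepData 1 K h1, χ.1.IsRegularAlgebraic ∧ ∀ᶠ v in cofinite, ∃ c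 : ℂ, χ.1.HasSatakeParamAt v {c} ∧ ψ.IsUnramifiedAt v ∧ ψ.HasFrobCharpolyAt v (Literature.NumberTheory.Automorphic.arithFrobPolyOfSatake ι v.residueCard 1 {c}))
    (h22 : JacquetShalika1981_partialPairL_boundary_repData)
    {K : Type} [Field K] [NumberField K] {hcpt : isCompact_glFiniteIntegralLevel 2 K}
    (π : CuspidalAutomorphicRepData 2 K hcpt)
    (hE : ∃ E : Subfield ℂ, FiniteDimensional ℚ E ∧
      ∀ᶠ v : HeightOneSpectrum (𝓞 K) in cofinite, ∀ α : Multiset ℂ, π.1.HasSatakeParamAt v α →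
        ∀ i ≤ 2, α.esymm i ∈ E)
    {ℓ : ℕ} [Fact ℓ.Prime] (ι : PadicAlgCl ℓ ≃+* ℂ) (ρ : FramedGaloisRep K (PadicAlgCl ℓ) 2)
    (hρ : ∀ᶠ v : HeightOneSpectrum (𝓞 K) in cofinite, SatakeFrobCompatibleAt ι π.1 ρ v) :
    ρ.toGaloisRep.IsIrreducible := by
  obtain ⟨E, hfd, hE⟩ := hE
  haveI : FiniteDimensional ℚ E := hfd
  haveI : NumberField E := NumberField.mk
  exact isIrreducible_rank_two_of_rational hWA h22 π ι
    ((ι.symm : ℂ ≃+* PadicAlgCl ℓ).toRingHom.comp E.subtype) ρ hρ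
    (eventually_rational_of_esymm_mem π.1 ι E hE ρ hρ)

/-- **The rank-two slice of the crux from Buzzard–Gee's Conjecture 3.1.6 for cuspidal `GL_2`.**
Grant the `WeakAbelianSummandHecke` text (Böckle–Hui Thm. 1.1, a theorem of the tree), Arthur–Clozel
(2.2), and the CONJECTURE (Buzzard–Gee 2014, Conj. 3.1.6, unramified places, cuspidal `GL_2`; a
theorem of Clozel for regular `π`, open for irregular `π`) that every L-algebraic cuspidal `π` on
`GL_2(𝔸_K)` is L-arithmetic: its unramified Hecke eigenvalues `e_i(t_{π,v})`, `i ≤ 2`, lie in a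
number field `E ⊂ ℂ` at almost all `v`.  Then the text of `IrreducibleOffSector` holds in rank two:
for every number field `K`, every L-algebraic cuspidal `π` on `GL_2(𝔸_K)`, every `ℓ`, `ι` and every
`ρ` Satake–Frobenius compatible with `(π, ι)` at almost all places, `ρ` is irreducible.  (In rank two
irreducibility is thus no harder than arithmeticity.)
[cite: BuzzardGeeLMS2014, Conj. 3.1.6] [cite: BockleHui2025, Theorem 1.1 and §3.2.1] -/
theorem irreducibleOffSector_text_rank_two_of_isLArithmetic
    (hWA : ∀ (K : Type) [Field K] [NumberField K] (h1 : isCompact_glFiniteIntegralLevel 1 K) (ℓ : ℕ) [Fact ℓ.Prime] (n : ℕ) (E : Type) [Field E] [NumberField E] (e : E →+* PadicAlgCl ℓ) (ρ : Literature.NumberTheory.GaloisRepresentations.FramedGaloisRep K (PadicAlgCl ℓ) n), ρ.toGaloisRep.IsSemisimple → (∀ᶠ v in cofinite, ρ.IsUnramifiedAt v ∧ ∃ P : Polynomial E, ρ.HasFrobCharpolyAt v (P.map e)) → ∀ (ψ : Literature.NumberTheory.GaloisRepresentations.FramedGaloisRep K (PadicAlgCl ℓ) 1), (∀ᶠ v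 in cofinite, ρ.IsUnramifiedAt v ∧ ψ.IsUnramifiedAt v ∧ ∀ 𝔓 ∈ v.primesAbove, ∀ σ : Field.absoluteGaloisGroup K, IsArithFrobAt (NumberField.RingOfIntegers K) σ 𝔓 → ψ.charpoly σ ∣ ρ.charpoly σ) → ∀ (ι : PadicAlgCl ℓ ≃+* ℂ), ∃ χ : Literature.NumberTheory.Automorphic.CuspidalAutomorphicRepData 1 K h1, χ.1.IsRegularAlgebraic ∧ ∀ᶠ v in cofinite, ∃ c : ℂ, χ.1.HasSatakeParamAt v {c} ∧ ψ.IsUnramifiedAt v ∧ ψ.HasFrobCharpolyAt v (Literature.NumberTheory.Automorphic.arithFrobPolyOfSatake ι v.residueCard 1 {c}))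
    (h22 : JacquetShalika1981_partialPairL_boundary_repData)
    (hLA : ∀ (K : Type) [Field K] [NumberField K] (hcpt : isCompact_glFiniteIntegralLevel 2 K)
      (π : CuspidalAutomorphicRepData 2 K hcpt), π.1.IsLAlgebraic →
        ∃ E : Subfield ℂ, FiniteDimensional ℚ E ∧
          ∀ᶠ v : HeightOneSpectrum (𝓞 K) in cofinite, ∀ α : Multiset ℂ, π.1.HasSatakeParamAt v α →
            ∀ i ≤ 2, α.esymm i ∈ E) :
    ∀ (K : Type) [Field K] [NumberField K] (hcpt : isCompact_glFiniteIntegralLevel 2 K)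
      (π : CuspidalAutomorphicRepData 2 K hcpt), π.1.IsLAlgebraic →
        ∀ (ℓ : ℕ) [Fact ℓ.Prime] (ι : PadicAlgCl ℓ ≃+* ℂ) (ρ : FramedGaloisRep K (PadicAlgCl ℓ) 2),
          (∀ᶠ v : HeightOneSpectrum (𝓞 K) in cofinite, SatakeFrobCompatibleAt ι π.1 ρ v) →
            ρ.toGaloisRep.IsIrreducible :=
  fun K _ _ hcpt π hL _ℓ _ ι ρ hρ =>
    isIrreducible_rank_two_of_isLArithmetic hWA h22 π (hLA K hcpt π hL) ι ρ hρ

end Summit.Langlands.Langlands.Theorems.IrreducibleOffSector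

end
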